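import Summits.QuantumFields.YangMills.Theorems.ConvexGribovBodyContinuumLegGivenGapStubCltOfCscl
import HarnessLib

/-!
# `ContinuumLegGivenGap` (stmt-QuantumFields-15828), line `Sketch`, reshape 17-CS, helper 7 of `stub_csclOfLock`:
# `HasCSClustering` of the canonical scheme from the Cauchy–Schwarz inequality for sums of curvature tensors

The converse bookkeeping of the landed `clustersCS_sum`: `SpeciesScheme.HasCSClustering r (canon r sch) Δ` (the
lattice statement `ClustersCS` over ALL species strings and all finite families of slab-ordered real factor data)
follows from the inequality in `curvDistribution` form for explicit finite sums `P = ∑ cᵢ gᵢ`, `Q = ∑ c'ⱼ g'ⱼ` of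
slab-ordered real product tensors (`cscl_hasCSClustering_of_sums`): strings touching a species other than the
curvature contribute nothing (`latticeSchwinger_canon_eq_zero`, the species-zeroing licence of `canon`), and on
curvature strings every term is a canonical curvature distribution (`latticeSchwinger_canon_eq_curvDistribution`),
the sums expanding sesquilinearly (`curvCLM`). Registered anchor: `cscl_anchor_reduce`. No definitions. [folklore]
-/

noncomputable section

open scoped SchwartzMap ComplexConjugate
open MeasureTheory Filter Topology
open Literature.MathematicalPhysics.QuantumFieldTheory Literature.MathematicalPhysics.QuantumLattice
  Literature.MathematicalPhysics.AQFT Literature.Probability.LatticeModels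
open Summit.QuantumFields.YangMills.Cruxes.ContinuumLimitOnTrajectory.TwoOrbitSynchronisation
  (curvDistribution curvNPoint canon curvCLM curvCLM_apply curvDistribution_tensor latticeSchwinger_canon_curv
   latticeSchwinger_canon_eq_zero)
open Summit.QuantumFields.YangMills.Cruxes.LatticeGapOnTrajectory.OrbitKantorovichFiniteSize.Transfer
  (isTensorOf_osAdjoint_appendTensor_translateMulti)

namespace Summit.QuantumFields.YangMills.Theorems.ContinuumLegGivenGap

section Reduce

variable {G : Type} [Group G] [TopologicalSpace G] [IsTopologicalGroup G] [CompactSpace G]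
  [MeasurableSpace G] [BorelSpace G] (r : LatticeRep G) (sch : SpeciesScheme (YMSpecies G))

/-- A reversed string that is not constantly the curvature touches another species. [folklore] -/
theorem cscl_append_left_ne {n m : ℕ} {σ : Fin n → YMSpecies G} {i : Fin n} (hi : σ i ≠ r.curvature)
    (σ' : Fin m → YMSpecies G) :
    Fin.append (σ ∘ Fin.rev) σ' (Fin.castAdd m (Fin.rev i)) ≠ r.curvature := by
  simpa [Fin.append_left] using hi

/-- An appended string whose right part is not constantly the curvature touches another species. [folklore] -/
theorem cscl_append_right_ne {n m : ℕ} (σ : Fin n → YMSpecies G) {σ' : Fin m → YMSpecies G} {j : Fin m}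
    (hj : σ' j ≠ r.curvature) :
    Fin.append (σ ∘ Fin.rev) σ' (Fin.natAdd n j) ≠ r.curvature := by
  simpa [Fin.append_right] using hj

/-- **`HasCSClustering` of the canonical scheme from the inequality for sums of curvature tensors.** [folklore] -/
theorem cscl_hasCSClustering_of_sums {Δ : ℝ}
    (H : ∀ (n m : ℕ), n ≠ 0 → m ≠ 0 → ∀ (N N' : ℕ) (c : Fin N → ℂ) (c' : Fin N' → ℂ)
      (g : Fin N → 𝓢((Fin n → EuclideanSpace ℝ (Fin 4)), ℂ)) (g' : Fin N' → 𝓢((Fin m → EuclideanSpace ℝ (Fin 4)), ℂ))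
      (p : Fin N → Fin n → 𝓢(EuclideanSpace ℝ (Fin 4), ℝ)) (q : Fin N' → Fin m → 𝓢(EuclideanSpace ℝ (Fin 4), ℝ)),
      (∀ i, IsTensorOf (g i) fun l => ofRealTest (p i l)) → (∀ i, IsSlabOrdered (p i)) →
      (∀ j, IsTensorOf (g' j) fun l => ofRealTest (q j l)) → (∀ j, IsSlabOrdered (q j)) →
      ∀ t : ℝ, 0 ≤ t → ∀ ε : ℝ, 0 < ε → ∀ᶠ k in atTop,
        ‖curvDistribution r sch k (n + m) ((osAdjoint (∑ i, c i • g i)).appendTensor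
              (translateMulti (EuclideanSpace.single 0 t) (∑ j, c' j • g' j))) -
            curvDistribution r sch k n (osAdjoint (∑ i, c i • g i)) * curvDistribution r sch k m (∑ j, c' j • g' j)‖ ≤
          Real.exp (-Δ * t) *
              Real.sqrt ‖curvDistribution r sch k (n + n) ((osAdjoint (∑ i, c i • g i)).appendTensor (∑ i, c i • g i))‖ *
              Real.sqrt ‖curvDistribution r sch k (m + m)
                ((osAdjoint (∑ j, c' j • g' j)).appendTensor (∑ j, c' j • g' j))‖ + ε) :
    SpeciesScheme.HasCSClustering r (canon r sch) Δ := by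
  intro n m hn hm σ σ' N N' c c' p q hp hq t ht ε hε
  -- strings touching another species contribute nothing
  by_cases hσ : ∃ i, σ i ≠ r.curvature
  · obtain ⟨i, hi⟩ := hσ
    refine Eventually.of_forall fun k => ?_
    have h1 : ∀ (i' : Fin N) (j : Fin N'), latticeSchwinger r.ρ (canon r sch) (fun s => s.F) k (n + m)
        (Fin.append (σ ∘ Fin.rev) σ') (Fin.append (fun l => thetaTest 4 (p i' (Fin.rev l)))
          (fun l => translateTest (EuclideanSpace.single 0 t) (q j l))) = 0 := fun i' j =>
      latticeSchwinger_canon_eq_zero r sch k (n + m) _ _ (cscl_append_left_ne r hi σ')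
    have h2 : ∀ i' : Fin N, latticeSchwinger r.ρ (canon r sch) (fun s => s.F) k n (σ ∘ Fin.rev)
        (fun l => thetaTest 4 (p i' (Fin.rev l))) = 0 := fun i' =>
      latticeSchwinger_canon_eq_zero r sch k n _ _ (i := Fin.rev i) (by simpa using hi)
    simp only [h1, h2, Complex.ofReal_zero, zero_mul, sub_zero, mul_zero, Finset.sum_const_zero, norm_zero]
    positivity
  by_cases hσ' : ∃ j, σ' j ≠ r.curvature
  · obtain ⟨j, hj⟩ := hσ'
    refine Eventually.of_forall fun k => ?_
    have h1 : ∀ (i : Fin N) (j' : Fin N'), latticeSchwinger r.ρ (canon r sch) (fun s => s.F) k (n + m)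
        (Fin.append (σ ∘ Fin.rev) σ') (Fin.append (fun l => thetaTest 4 (p i (Fin.rev l)))
          (fun l => translateTest (EuclideanSpace.single 0 t) (q j' l))) = 0 := fun i j' =>
      latticeSchwinger_canon_eq_zero r sch k (n + m) _ _ (cscl_append_right_ne r σ hj)
    have h3 : ∀ j' : Fin N', latticeSchwinger r.ρ (canon r sch) (fun s => s.F) k m σ' (q j') = 0 := fun j' =>
      latticeSchwinger_canon_eq_zero r sch k m _ _ hj
    simp only [h1, h3, Complex.ofReal_zero, sub_zero, mul_zero, Finset.sum_const_zero, norm_zero]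
    positivity
  push Not at hσ hσ'
  obtain rfl : σ = fun _ => r.curvature := funext hσ
  obtain rfl : σ' = fun _ => r.curvature := funext hσ'
  -- curvature strings: the real product tensors `gᵢ = ⊗ pᵢ`, `g'ⱼ = ⊗ qⱼ`
  set g : Fin N → 𝓢((Fin n → EuclideanSpace ℝ (Fin 4)), ℂ) := fun i => SchwartzMap.tensorFin n fun l => ofRealTest (p i l)
  set g' : Fin N' → 𝓢((Fin m → EuclideanSpace ℝ (Fin 4)), ℂ) := fun j => SchwartzMap.tensorFin m fun l => ofRealTest (q j l)
  have hpT : ∀ i, IsTensorOf (g i) fun l => ofRealTest (p i l) := fun i => isTensorOf_tensorFin _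
  have hqT : ∀ j, IsTensorOf (g' j) fun l => ofRealTest (q j l) := fun j => isTensorOf_tensorFin _
  filter_upwards [H n m hn hm N N' c c' g g' p q hpT hp hqT hq t ht ε hε] with k hk
  have key := latticeSchwinger_canon_eq_curvDistribution r sch k
  simp only [fun (i : Fin N) (j : Fin N') => key (n + m) _ (append_const_curvature r) _
      (isTensorOf_osAdjoint_appendTensor_translateMulti (hpT i) (hqT j) (EuclideanSpace.single 0 t)),
    fun (i : Fin N) => key n ((fun _ : Fin n => r.curvature) ∘ Fin.rev) (fun _ => rfl) _ (hpT i).osAdjoint,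
    fun (j : Fin N') => key m (fun _ : Fin m => r.curvature) (fun _ => rfl) _ (hqT j),
    fun (i i' : Fin N) => key (n + n) _ (append_const_curvature r) _
      (by simpa only [append_ofRealTest] using (hpT i).osAdjoint.appendTensor (hpT i')),
    fun (j j' : Fin N') => key (m + m) _ (append_const_curvature r) _
      (by simpa only [append_ofRealTest] using (hqT j).osAdjoint.appendTensor (hqT j'))]
  simp only [← curvCLM_apply] at hk ⊢
  rw [map_sum (translateMulti (EuclideanSpace.single (0 : Fin 4) t)),
    Finset.sum_congr rfl fun j _ => map_smul (translateMulti (EuclideanSpace.single (0 : Fin 4) t)) _ _] at hk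
  simp only [apply_osAdjoint_appendTensor_sum_smul, apply_osAdjoint_sum_smul, apply_sum_smul] at hk
  convert hk using 3
  rw [Finset.sum_mul_sum, ← Finset.sum_sub_distrib]
  refine Finset.sum_congr rfl fun i _ => ?_
  rw [← Finset.sum_sub_distrib]
  exact Finset.sum_congr rfl fun j _ => by ring

end Reduce

/-- **Registered anchor of this file** (closed form of `cscl_append_right_ne`, for the gate's `--supports` stub check).
[folklore] -/
theorem cscl_anchor_reduce :
    ∀ (G : Type) [Group G] [TopologicalSpace G] [IsTopologicalGroup G] [CompactSpace G] [MeasurableSpace G]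
      [BorelSpace G] (r : LatticeRep G) (n m : ℕ) (σ : Fin n → YMSpecies G) (σ' : Fin m → YMSpecies G) (j : Fin m),
      σ' j ≠ r.curvature → Fin.append (σ ∘ Fin.rev) σ' (Fin.natAdd n j) ≠ r.curvature :=
  fun _ _ _ _ _ _ _ r _ _ σ _ _ hj => cscl_append_right_ne r σ hj

end Summit.QuantumFields.YangMills.Theorems.ContinuumLegGivenGap

end
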